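import Mathlib
import HarnessLib
import Summits.Ventures.LatticeQCDFlow.Exactness.IMHSignObservableSandwich
import Summits.Ventures.LatticeQCDFlow.Exactness.SphereIndependenceSamplerAcceptance
import Summits.Ventures.LatticeQCDFlow.Exactness.LatticeBlockSecondMomentTensorization

/-!
# The integrated autocorrelation time of a balanced sign observable of an independence sampler on the lattice of spheres: `∫e^{−2F}dπ̄/(∫e^{−F}dπ̄)² − ½ ≤ τ_int ≤ ½ + 12·∫e^{−2F}dπ̄/(∫e^{−F}dπ̄)²`, and the block tensorization `τ_int ≥ e^{−4δ}·exp(Σ_j e^{−4M_j}Var(A_C h_j)/(1 + M_j²)) − ½`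

HONEST FRAMING: exact (Metropolis-corrected) sampling algorithms for lattice gauge theory;
figures of merit are autocorrelation/cost numbers at stated couplings and volumes; no
continuum-physics claim.

Venture `LatticeQCDFlow` (cell pub-lqcd), topic `Exactness`; FANOUT row 7 (`s0-cpn-null`: the
S0-D1 rung — 2D CP⁹, Lüscher's LO trivializing map inside HMC, Engel–Schaefer 2011).  NEW WORK of
the cell, a BRIDGE between two of its lines: row 2's `Exactness/IMHSignObservableSandwich.lean`
(`imhOp_sign_tauInt_sandwich`: on a general state space, for the exact flow sampler with
square-integrable weights and every balanced sign observable, `1/κ − ½ ≤ τ_int ≤ ½ + 12/κ`, `κ` the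
effective-sample-size fraction `(∫w)²/∫w²` of the raw importance sampler — built on row 2's exact
formula for `τ_int` and row 30's general-state IMH kernel) and this lineage's
`Exactness/LatticeBlockSecondMomentTensorization.lean` (the non-product tensorization
`(∫e^{−F})²·exp(Σ_j e^{−4M_j}Var(A_C h_j)/(1 + M_j²)) ≤ e^{4δ}∫e^{−2F}` of the second moment of the
weights through the corridor conditional expectation); nothing is cited as a fact.  Printed
counterparts, NAMED ONLY: the flow-based independence Metropolis sampler of Albergo–Kanwar–Shanahan,
Phys. Rev. D 100 (2019) 034515, §II; Madras–Sokal 1988 / Wolff 2004 (`τ_int = ½ + Σ_{t≥1} ρ(t)`);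
Abbott et al., Phys. Rev. D 106 (2022) 074506, §V.  THE FIGURE OF MERIT AS A THEOREM.  On
`Ω = S(E)^Λ` with `π̄ = ⊗_Λ σ̄`, the flow-based independence sampler with a continuous log-weight `F`
(target `π̄.tilted(−F)`, proposal `π̄`; this lineage's `SphereIndependenceSamplerAcceptance`) is row
2's operator `imhOp π̄ e^{−F} 1`; its weights are
bounded, so the sandwich applies unconditionally: for every measurable `g` with `g² = 1` and
`∫ g e^{−F} dπ̄ = 0` (a balanced sign observable — the indicator-minus-coindicator of any event of
target probability `½`), `∫e^{−2F}dπ̄/(∫e^{−F}dπ̄)² − ½ ≤ τ_int(g) ≤ ½ + 12·∫e^{−2F}dπ̄/(∫e^{−F}dπ̄)²`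
— and the tensorization then makes the FLOOR a product over blocks of factors `> 1`: a log-weight
that is, up to `δ`, a sum of `#T` congruent non-degenerate block-local terms forces
`τ_int ≥ exp(#T·θ − 4δ) − ½` for every balanced sign observable.  The sequel
`Exactness/TorusLinkSignObservableTauInt.lean` evaluates this for the exact leading-order flow of the
model of record (`τ_int` exponentially large in the volume at fixed small flow time).

## Content (`F` continuous on `Ω`; `ρ_g(k) = ∫ g·(Kᵏg)·e^{−F}dπ̄ / ∫ g²e^{−F}dπ̄`, `K = imhOp π̄ e^{−F} 1`;
## `τ_int = Scoring.tauInt ρ_g = ½ + Σ_{k≥1} ρ_g(k)`)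

* `imhAcceptQ_exp_neg_one` — the acceptance of `imhOp π̄ e^{−F} 1` is `min(1, e^{F(ω) − F(ω')})`.
* **`indepSampler_sign_tauInt_sandwich`** — `∫e^{−2F}/(∫e^{−F})² − ½ ≤ τ_int(g) ≤ ½ + 12·∫e^{−2F}/(∫e^{−F})²`
  for every balanced sign observable `g`.
* **`indepSampler_exp_blockSum_sub_half_le_sign_tauInt`** — THE TENSORIZED `τ_int` FLOOR: blocks `B_j ⊆ D_j` with
  the `D_j` pairwise disjoint, `h_j` continuous depending on `D_j` with oscillation `≤ M_j`, `r`
  continuous depending on the complement of `⋃_j B_j`, `C = Λ ∖ ⋃_j B_j`, `|F − (Σ_j h_j + r)| ≤ δ`: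
  `e^{−4δ}·exp(Σ_j e^{−4M_j}·Var_π̄(A_C h_j)/(1 + M_j²)) − ½ ≤ τ_int(g)`.

NOT CLAIMED: observables with non-constant `g²` (row 2's `imhOp_tauInt_ge_weightMean` covers them with
the `g²`-weighted second moment, not tensorized here); anything model-specific; numbers.
-/

noncomputable section

namespace Summit.Ventures.LatticeQCDFlow.Exactness

open Function Set Metric MeasureTheory NormedSpace InnerProductSpace
open Summit.Ventures.LatticeQCDFlow.Scoring
open scoped RealInnerProductSpace Topology

variable {Λ : Type*} {E : Type*} [NormedAddCommGroup E] [InnerProductSpace ℝ E]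
  [FiniteDimensional ℝ E] [Fintype Λ] [DecidableEq Λ] [MeasurableSpace E] [BorelSpace E] [Nontrivial E]

/-! ## §1 The independence sampler on the lattice of spheres as row 2's `imhOp` -/

section Bridge

/-- With target weight `e^{−F}` and proposal density `1` (proposal `π̄` itself), row 2's acceptance
`imhAcceptQ` is the flow sampler's `min(1, e^{F(ω) − F(ω')})`. -/
theorem imhAcceptQ_exp_neg_one {Y : Type*} (F : Y → ℝ) (ω ω' : Y) :
    imhAcceptQ (fun η => Real.exp (-F η)) (fun _ => (1 : ℝ)) ω ω' = min 1 (Real.exp (F ω - F ω')) := by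
  unfold imhAcceptQ
  rw [mul_one, mul_one, ← Real.exp_sub]
  congr 2
  ring

omit [DecidableEq Λ] in
/-- **THE SIGN-OBSERVABLE SANDWICH ON THE LATTICE OF SPHERES.**  For a continuous log-weight `F` on
`Ω` and every measurable `g` with `g² = 1` and `∫ g e^{−F} dπ̄ = 0`:
`∫e^{−2F}dπ̄/(∫e^{−F}dπ̄)² − ½ ≤ τ_int(g) ≤ ½ + 12·∫e^{−2F}dπ̄/(∫e^{−F}dπ̄)²`, `τ_int(g)` the
integrated autocorrelation time of `g` along the stationary exact chain `imhOp π̄ e^{−F} 1`. -/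
theorem indepSampler_sign_tauInt_sandwich {F : (Λ → sphere (0 : E) 1) → ℝ} (hF : Continuous F)
    {g : (Λ → sphere (0 : E) 1) → ℝ} (hgm : Measurable g) (hg1 : ∀ ω, g ω ^ 2 = 1)
    (hg0 : ∫ ω, g ω * Real.exp (-F ω) ∂Measure.pi (fun _ : Λ => uniformSphere (volume : Measure E)) = 0) :
    (∫ ω, Real.exp (-2 * F ω) ∂Measure.pi (fun _ : Λ => uniformSphere (volume : Measure E))) /
          (∫ ω, Real.exp (-F ω) ∂Measure.pi (fun _ : Λ => uniformSphere (volume : Measure E))) ^ 2 -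
        1 / 2 ≤
      tauInt (fun k => (∫ ω, g ω *
          ((imhOp (Measure.pi (fun _ : Λ => uniformSphere (volume : Measure E)))
            (fun η => Real.exp (-F η)) (fun _ => (1 : ℝ)))^[k] g) ω * Real.exp (-F ω)
            ∂Measure.pi (fun _ : Λ => uniformSphere (volume : Measure E))) /
          ∫ ω, g ω ^ 2 * Real.exp (-F ω) ∂Measure.pi (fun _ : Λ => uniformSphere (volume : Measure E))) ∧
    tauInt (fun k => (∫ ω, g ω *
          ((imhOp (Measure.pi (fun _ : Λ => uniformSphere (volume : Measure E)))
            (fun η => Real.exp (-F η)) (fun _ => (1 : ℝ)))^[k] g) ω * Real.exp (-F ω)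
            ∂Measure.pi (fun _ : Λ => uniformSphere (volume : Measure E))) /
          ∫ ω, g ω ^ 2 * Real.exp (-F ω) ∂Measure.pi (fun _ : Λ => uniformSphere (volume : Measure E))) ≤
      1 / 2 + 12 * (∫ ω, Real.exp (-2 * F ω) ∂Measure.pi (fun _ : Λ => uniformSphere (volume : Measure E))) /
          (∫ ω, Real.exp (-F ω) ∂Measure.pi (fun _ : Λ => uniformSphere (volume : Measure E))) ^ 2 := by
  set μ : Measure (Λ → sphere (0 : E) 1) := Measure.pi (fun _ : Λ => uniformSphere (volume : Measure E))
    with hμ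
  have hwc : Continuous fun η : Λ → sphere (0 : E) 1 => Real.exp (-F η) := hF.neg.rexp
  have hw0 : ∀ η : Λ → sphere (0 : E) 1, 0 < Real.exp (-F η) := fun η => Real.exp_pos _
  have hwm : Measurable fun η : Λ → sphere (0 : E) 1 => Real.exp (-F η) := hwc.measurable
  have hwi : Integrable (fun η : Λ → sphere (0 : E) 1 => Real.exp (-F η)) μ :=
    integrable_pi_of_continuous _ hwc
  have hq0 : ∀ _η : Λ → sphere (0 : E) 1, (0 : ℝ) < 1 := fun _ => one_pos
  have hqm : Measurable fun _ : Λ → sphere (0 : E) 1 => (1 : ℝ) := measurable_const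
  have hqi : Integrable (fun _ : Λ → sphere (0 : E) 1 => (1 : ℝ)) μ := integrable_const _
  have hq1 : ∫ _ : Λ → sphere (0 : E) 1, (1 : ℝ) ∂μ = 1 := by
    rw [integral_const, smul_eq_mul, mul_one, probReal_univ]
  have hW₂ : Integrable (fun η : Λ → sphere (0 : E) 1 => Real.exp (-F η) / 1 * Real.exp (-F η)) μ := by
    simp_rw [div_one]
    exact integrable_pi_of_continuous _ (hwc.mul hwc)
  have h := imhOp_sign_tauInt_sandwich hw0 hwm hwi hq0 hqm hqi hq1 hW₂ hgm hg1 hg0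
  have e2 : ∫ η, Real.exp (-F η) / 1 * Real.exp (-F η) ∂μ = ∫ η, Real.exp (-2 * F η) ∂μ := by
    refine integral_congr_ae (ae_of_all _ fun η => ?_)
    show Real.exp (-F η) / 1 * Real.exp (-F η) = Real.exp (-2 * F η)
    rw [div_one, ← Real.exp_add]
    congr 1
    ring
  rw [e2] at h
  have e12 : 1 / 2 + 12 * (∫ ω, Real.exp (-2 * F ω) ∂μ) / (∫ ω, Real.exp (-F ω) ∂μ) ^ 2 =
      1 / 2 + 12 * ((∫ ω, Real.exp (-2 * F ω) ∂μ) / (∫ ω, Real.exp (-F ω) ∂μ) ^ 2) := by ring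
  rw [e12]
  rw [mul_div_assoc] at h
  exact h

end Bridge

/-! ## §2 The tensorized `τ_int` floor -/

section Blocks

/-- **THE TENSORIZED `τ_int` FLOOR FOR BALANCED SIGN OBSERVABLES.**  Blocks `B_j ⊆ D_j` with the
`D_j` pairwise disjoint (`j ∈ T`); `h_j` continuous, depending on `D_j`, with oscillation `≤ M_j`
(`0 ≤ M_j`); `r` continuous depending on the complement of `⋃_j B_j`; `C = Λ ∖ ⋃_j B_j`; a
continuous log-weight `F` with `|F − (Σ_j h_j + r)| ≤ δ` on `Ω`.  Then for every measurable `g` with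
`g² = 1` and `∫ g e^{−F} dπ̄ = 0`:
`e^{−4δ}·exp(Σ_j e^{−4M_j}·∫(A_C h_j − ∫h_j)²dπ̄/(1 + M_j²)) − ½ ≤ τ_int(g)`. -/
theorem indepSampler_exp_blockSum_sub_half_le_sign_tauInt {J : Type*} (T : Finset J) (B D : J → Finset Λ)
    (hBD : ∀ j ∈ T, B j ⊆ D j) (hD : ∀ j ∈ T, ∀ j' ∈ T, j ≠ j' → Disjoint (D j) (D j'))
    {h : J → (Λ → sphere (0 : E) 1) → ℝ} (hc : ∀ j ∈ T, Continuous (h j))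
    (hdep : ∀ j ∈ T, DependsOn (h j) ↑(D j))
    {M : J → ℝ} (hM0 : ∀ j ∈ T, 0 ≤ M j) (hM : ∀ j ∈ T, ∀ ω ω', |h j ω - h j ω'| ≤ M j)
    {r : (Λ → sphere (0 : E) 1) → ℝ} (hr : Continuous r) (hrdep : DependsOn r (↑(T.biUnion B) : Set Λ)ᶜ)
    {F : (Λ → sphere (0 : E) 1) → ℝ} (hF : Continuous F) {δ : ℝ}
    (hδ : ∀ ω, |F ω - (∑ j ∈ T, h j ω + r ω)| ≤ δ)
    {g : (Λ → sphere (0 : E) 1) → ℝ} (hgm : Measurable g) (hg1 : ∀ ω, g ω ^ 2 = 1)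
    (hg0 : ∫ ω, g ω * Real.exp (-F ω) ∂Measure.pi (fun _ : Λ => uniformSphere (volume : Measure E)) = 0) :
    Real.exp (-(4 * δ)) * Real.exp (∑ j ∈ T, Real.exp (-4 * M j) *
        (∫ ω, (coordAvg (uniformSphere (volume : Measure E)) (Finset.univ \ T.biUnion B) (h j) ω -
            ∫ ω', h j ω' ∂Measure.pi (fun _ : Λ => uniformSphere (volume : Measure E))) ^ 2
          ∂Measure.pi (fun _ : Λ => uniformSphere (volume : Measure E))) / (1 + M j ^ 2)) - 1 / 2 ≤
      tauInt (fun k => (∫ ω, g ω *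
          ((imhOp (Measure.pi (fun _ : Λ => uniformSphere (volume : Measure E)))
            (fun η => Real.exp (-F η)) (fun _ => (1 : ℝ)))^[k] g) ω * Real.exp (-F ω)
            ∂Measure.pi (fun _ : Λ => uniformSphere (volume : Measure E))) /
          ∫ ω, g ω ^ 2 * Real.exp (-F ω) ∂Measure.pi (fun _ : Λ => uniformSphere (volume : Measure E))) := by
  set σ : Measure (sphere (0 : E) 1) := uniformSphere (volume : Measure E) with hσ
  set μ : Measure (Λ → sphere (0 : E) 1) := Measure.pi (fun _ : Λ => σ) with hμ
  have hsand := (indepSampler_sign_tauInt_sandwich (Λ := Λ) (E := E) hF hgm hg1 hg0).1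
  refine le_trans ?_ hsand
  -- `e^{−4δ}·exp(S) ≤ ∫e^{−2F}/(∫e^{−F})²` from the tensorized second-moment floor
  have hmain := sq_integral_exp_neg_mul_exp_le_of_abs_sub_le σ T B D hBD hD hc hdep hM0 hM hr hrdep hF hδ
  have hZpos : 0 < ∫ ω, Real.exp (-F ω) ∂μ :=
    integral_exp_pos (integrable_pi_of_continuous _ (Real.continuous_exp.comp hF.neg))
  have hZ2 : 0 < (∫ ω, Real.exp (-F ω) ∂μ) ^ 2 := pow_pos hZpos 2
  have key : Real.exp (-(4 * δ)) * Real.exp (∑ j ∈ T, Real.exp (-4 * M j) *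
        (∫ ω, (coordAvg σ (Finset.univ \ T.biUnion B) (h j) ω - ∫ ω', h j ω' ∂μ) ^ 2 ∂μ) / (1 + M j ^ 2)) ≤
      (∫ ω, Real.exp (-2 * F ω) ∂μ) / (∫ ω, Real.exp (-F ω) ∂μ) ^ 2 := by
    rw [le_div_iff₀ hZ2, Real.exp_neg, inv_mul_eq_div, div_mul_eq_mul_div,
      div_le_iff₀ (Real.exp_pos _)]
    calc Real.exp (∑ j ∈ T, Real.exp (-4 * M j) *
            (∫ ω, (coordAvg σ (Finset.univ \ T.biUnion B) (h j) ω - ∫ ω', h j ω' ∂μ) ^ 2 ∂μ) / (1 + M j ^ 2)) *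
          (∫ ω, Real.exp (-F ω) ∂μ) ^ 2
        = (∫ ω, Real.exp (-F ω) ∂μ) ^ 2 * Real.exp (∑ j ∈ T, Real.exp (-4 * M j) *
            (∫ ω, (coordAvg σ (Finset.univ \ T.biUnion B) (h j) ω - ∫ ω', h j ω' ∂μ) ^ 2 ∂μ) / (1 + M j ^ 2)) :=
          mul_comm _ _
      _ ≤ Real.exp (4 * δ) * ∫ ω, Real.exp (-2 * F ω) ∂μ := hmain
      _ = (∫ ω, Real.exp (-2 * F ω) ∂μ) * Real.exp (4 * δ) := mul_comm _ _
  linarith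

end Blocks

end Summit.Ventures.LatticeQCDFlow.Exactness

end
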